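import Literature.AlgebraicGeometry.Resolution.SmoothDescentFlat
import Literature.AlgebraicGeometry.Resolution.SmoothFibreCriterionPointwise
import HarnessLib

/-!
# `WildQuotients.SummitReduction` (stmt-ResolutionOfSingularities-16324), line `FramePerfect`:
# smoothness at a point from flatness and regularity of the fibre after finite purely inseparable
# extensions of the residue field (algebra of stub `stub_pair_orbitBlowupCentreLocal`, file 13)

Route `ResolutionOfSingularities/WildQuotients`, crux `SummitReduction`; helper file of stub
`stub_pair_orbitBlowupCentreLocal` (C2: de Jong 1996, 3.4 Claim (ii) over the orbit centre). Clause
(H4) of the stub needs the blown-up curve `X₁ → Y` to be SMOOTH at the points over the centre which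
are not origins of their charts ("This scheme is smooth over `k`, except at the maximal ideal
`(u, t₁')`", de Jong 1996, p. 64). Flatness there is a theorem (stub C1), and the engine of file 9
gives regularity of the local rings of `l' ⊗_{κ(y)} (fibre)` at the points over such a point for
every field extension `l'/κ(y)`. This file PROVES the two generic steps closing the gap, for a
finitely presented algebra and Mathlib's pointwise smoothness `Algebra.IsSmoothAt`:

* `isSmoothAt_of_flat_of_isSmoothAt_fiber` — **the fibre criterion at a point with flatness only
  at the point** (Stacks 00TF / 01V8; the tree's `isSmoothAt_comap_iff_isSmoothAt_fiber` assumes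
  global flatness): `S` is `R`-smooth at `q` if `R_p → S_q` is flat and the fibre ring
  `κ(p) ⊗_R S` is `κ(p)`-smooth at the prime `q'` over `q`;
* `isSmoothAt_of_forall_isRegularLocalRing_baseChange` — **smoothness at a point of an algebra of
  finite type over a field `l` from regularity, at the primes over the point, of its base changes
  to the finite purely inseparable extensions of `l`** (Stacks 00TV with 05AX: after a finite
  purely inseparable `l₀/l` the residue field becomes separable over `l₀`, regular + separable
  residue field ⇒ smooth, and smoothness descends along the faithfully flat `l → l₀`; the tree's
  `isSmoothAt_comap_of_flat_of_field` with its regularity step made a hypothesis).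
-/

set_option linter.dupNamespace false

noncomputable section

open IsLocalRing TensorProduct
open Literature.AlgebraicGeometry.Resolution

namespace Summit.ResolutionOfSingularities.ResolutionOfSingularities.Theorems

universe u

/-! ## The fibre criterion with flatness at the point -/

section FibreCriterion

variable {R : Type u} {S : Type u} [CommRing R] [CommRing S] [Algebra R S]

set_option backward.isDefEq.respectTransparency false in
open _root_.Algebra in
/-- **Pointwise fibre criterion of smoothness, with flatness at the point** (The Stacks Project,
Tag 01V8: "Assume `f` is locally of finite presentation, `f` is flat at `x`, and the fibre `X_{f(x)}`
is smooth at `x`. Then `f` is smooth at `x`"): for `S` of finite presentation over `R`, a prime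
`p ⊂ R`, a prime `q'` of the fibre ring `κ(p) ⊗_R S` over the prime `q = q' ∩ S` over `p`, if
`R_p → S_q` is flat and `κ(p) ⊗_R S` is `κ(p)`-smooth at `q'`, then `S` is `R`-smooth at `q`
(through `(κ(p) ⊗_R S)_{q'} ≅ κ(p) ⊗_{R_p} S_q` and Mathlib's
`Algebra.FormallySmooth.of_formallySmooth_residueField_tensor`). [cite: StacksProject, Tag 01V8] -/
theorem isSmoothAt_of_flat_of_isSmoothAt_fiber [Algebra.FinitePresentation R S]
    (p : Ideal R) [p.IsPrime] (q' : Ideal (p.Fiber S)) [q'.IsPrime]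
    (hpq : p = (q'.comap (Algebra.TensorProduct.includeRight :
        S →ₐ[R] p.Fiber S).toRingHom).comap (algebraMap R S))
    (hflat : (Localization.localRingHom p (q'.comap (Algebra.TensorProduct.includeRight :
        S →ₐ[R] p.Fiber S).toRingHom) (algebraMap R S) hpq).Flat)
    (h : Algebra.IsSmoothAt p.ResidueField q') :
    Algebra.IsSmoothAt R (q'.comap (Algebra.TensorProduct.includeRight :
        S →ₐ[R] p.Fiber S)) := by
  set q : Ideal S := q'.comap (Algebra.TensorProduct.includeRight : S →ₐ[R] p.Fiber S) with hq
  haveI hqp : q.LiesOver p := ⟨hpq⟩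
  -- notation
  let Rp := Localization.AtPrime p
  let Sq := Localization.AtPrime q
  letI := Localization.AtPrime.algebraOfLiesOver p q
  haveI : Module.Flat Rp Sq := hflat
  let k := p.ResidueField
  -- `(κ(p) ⊗ S)_{q'} ≃ S_q / p S_q ≃ S_q / 𝔪_p S_q ≃ κ(p) ⊗_{R_p} S_q`, over `R_p`
  let e₁ : Localization.AtPrime q' ≃ₐ[Rp] Sq ⧸ p.map (algebraMap R Sq) :=
    Ideal.Fiber.localizationAlgEquivQuotient p q'
  have hmap : p.map (algebraMap R Sq) = (maximalIdeal Rp).map (algebraMap Rp Sq) := by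
    rw [← Localization.AtPrime.map_eq_maximalIdeal, Ideal.map_map,
      ← IsScalarTower.algebraMap_eq]
  let e₂ : (Sq ⧸ p.map (algebraMap R Sq)) ≃ₐ[Rp] Sq ⧸ (maximalIdeal Rp).map (algebraMap Rp Sq) :=
    Ideal.quotientEquivAlgOfEq Rp hmap
  let e₃ : k ⊗[Rp] Sq ≃ₐ[Rp] Sq ⧸ (maximalIdeal Rp).map (algebraMap Rp Sq) :=
    (Algebra.TensorProduct.comm _ _ _).trans
      ((Algebra.TensorProduct.quotIdealMapEquivTensorQuot Sq (maximalIdeal Rp)).symm.restrictScalars _)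
  let E : Localization.AtPrime q' ≃ₐ[Rp] k ⊗[Rp] Sq := e₁.trans (e₂.trans e₃.symm)
  -- `E` is `κ(p)`-linear (`R_p → κ(p)` is onto)
  have hE : ∀ (c : k) (x : Localization.AtPrime q'), E (c • x) = c • E x := by
    intro c x
    obtain ⟨r, rfl⟩ := IsLocalRing.residue_surjective c
    rw [← ResidueField.algebraMap_eq, algebraMap_smul, algebraMap_smul, map_smul]
  have h1 : ∀ c : k, E (algebraMap k _ c) = algebraMap k _ c := by
    intro c
    rw [Algebra.algebraMap_eq_smul_one, hE, map_one, Algebra.algebraMap_eq_smul_one]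
  let E' : Localization.AtPrime q' ≃ₐ[k] k ⊗[Rp] Sq :=
    { E with
      commutes' := fun c => by
        have := h1 c
        exact this }
  haveI : Algebra.FormallySmooth k (Localization.AtPrime q') := h
  haveI : Algebra.FormallySmooth k (k ⊗[Rp] Sq) :=
    Algebra.FormallySmooth.of_equiv (A := Localization.AtPrime q') E'
  -- `S_q` is a localization of the finitely presented `R_p`-algebra `S_p`
  let Sp := Localization (algebraMapSubmonoid S p.primeCompl)
  let f : Sp →ₐ[S] Sq := IsLocalization.liftAlgHom (M := algebraMapSubmonoid S p.primeCompl)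
        (f := Algebra.ofId _ _) (by
      rintro ⟨_, x, hx, rfl⟩
      simpa using! IsLocalization.map_units (M := q.primeCompl) Sq ⟨algebraMap _ _ x,
        by simp_all [q.over_def p]⟩)
  algebraize [f.toRingHom]
  have : IsScalarTower R Sp Sq := .to₁₃₄ _ S _ _
  have : IsScalarTower Rp Sp Sq := .of_algebraMap_eq' <| by
    apply IsLocalization.ringHom_ext p.primeCompl
    simp only [RingHom.comp_assoc, ← IsScalarTower.algebraMap_eq]
  have : IsLocalization (algebraMapSubmonoid Sp q.primeCompl) Sq :=
    .isLocalization_of_submonoid_le _ _ (algebraMapSubmonoid S p.primeCompl) _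
    (by rintro _ ⟨x, hx, rfl⟩; simp_all [q.over_def p])
  have : Algebra.FinitePresentation Rp Sp := by
    have : Algebra.IsPushout R Rp S Sp :=
      .symm <| Algebra.isPushout_of_isLocalization p.primeCompl _ _ _
    exact .equiv (Algebra.IsPushout.equiv R Rp S Sp)
  have := Algebra.FormallySmooth.of_formallySmooth_residueField_tensor
    (R := Rp) (S := Sq) (P := Sp) (algebraMapSubmonoid _ q.primeCompl)
  exact Algebra.FormallySmooth.comp R Rp Sq

end FibreCriterion

/-! ## Smoothness at a point from regularity after finite purely inseparable extensions -/

section Descent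

/-- **Smoothness at a point of an algebra of finite type over a field from regularity of its base
changes to finite purely inseparable extensions** (The Stacks Project, Tags 00TV and 05AX): let
`F` be of finite type over the field `l` and `q ⊂ F` a prime; if for every finite purely
inseparable extension `l₀/l` the local rings of `l₀ ⊗_l F` at the primes over `q` are regular,
then `F` is `l`-smooth at `q`. Proof (that of the tree's `isSmoothAt_comap_of_flat_of_field` with
its regularity step made the hypothesis): choose `l₀/l` finite purely inseparable making every
compositum of `κ(q)` with `l₀` separable (`exists_purelyInseparable_formallySmooth_compositum`);
at the prime `x'` of `l₀ ⊗_l F` over `q` the local ring is regular (hypothesis) with separable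
residue field, hence `l₀ ⊗_l F` is `l₀`-smooth at `x'` (Stacks 00TV,
`isSmoothAt_of_isRegularLocalRing_of_formallySmooth_residueField`); a basic open neighbourhood
`D(1 ⊗ f)` of `x'` in the smooth locus gives `l₀ ⊗_l F_f` smooth over `l₀`, and smoothness descends
along the faithfully flat `l → l₀`. [cite: StacksProject, Tag 05AX] -/
theorem isSmoothAt_of_forall_isRegularLocalRing_baseChange (l : Type u) [Field l] (F : Type u)
    [CommRing F] [Algebra l F] [Algebra.FiniteType l F] (q : Ideal F) [q.IsPrime]
    (h : ∀ (l₀ : Type u) [Field l₀] [Algebra l l₀] [Module.Finite l l₀] [IsPurelyInseparable l l₀]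
      (x' : Ideal (l₀ ⊗[l] F)) [x'.IsPrime],
      x'.comap (Algebra.TensorProduct.includeRight (R := l) (A := l₀) :
        F →ₐ[l] l₀ ⊗[l] F).toRingHom = q → IsRegularLocalRing (Localization.AtPrime x')) :
    Algebra.IsSmoothAt l q := by
  classical
  haveI : Algebra.FinitePresentation l F := (Algebra.FinitePresentation.of_finiteType).mp ‹_›
  -- the residue field of `q` is finitely generated over `l`
  have hfg : (⊤ : IntermediateField l q.ResidueField).FG := by
    haveI : Algebra.EssFiniteType l q.ResidueField :=
      Algebra.EssFiniteType.comp l F q.ResidueField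
    exact IntermediateField.fg_top_iff.mpr this
  -- enlarge the constants so that every compositum of `κ(q)` with `l₀` is separable
  obtain ⟨l₀, _, _, hl₀fin, hl₀pi, hsep⟩ :=
    exists_purelyInseparable_formallySmooth_compositum l q.ResidueField hfg
  haveI := hl₀pi
  haveI : Module.Finite l l₀ := hl₀fin
  haveI : Algebra.IsAlgebraic l l₀ := inferInstance
  -- the prime `x′` of `l₀ ⊗ F` over `q`; `l₀ ⊗ F` is regular there (hypothesis), with separable
  -- residue field, hence `l₀`-smooth there
  obtain ⟨x', hx'p, hx'⟩ := exists_prime_comap_includeRight_eq (l := l) (l' := l₀) F q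
  haveI := hx'p
  haveI : Algebra.FormallySmooth l₀ (ResidueField (Localization.AtPrime x')) :=
    formallySmooth_residueField_baseChange_of_compositum F x' q hx'.symm hsep
  haveI : IsRegularLocalRing (Localization.AtPrime x') := h l₀ x' hx'
  haveI : Algebra.FinitePresentation l₀ (l₀ ⊗[l] F) := inferInstance
  haveI : Algebra.IsSmoothAt l₀ x' :=
    isSmoothAt_of_isRegularLocalRing_of_formallySmooth_residueField l₀ (l₀ ⊗[l] F) x'
  -- a basic open `D(1 ⊗ f) ∋ x′` inside the smooth locus
  obtain ⟨G, hGx', hGsm⟩ := Algebra.IsSmoothAt.exists_notMem_smooth l₀ x'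
  obtain ⟨p, hp⟩ := ExpChar.exists l
  obtain ⟨n, f, hf⟩ := exists_pow_mem_range_includeRight F p G
  have hGpow : G ^ p ^ n = (1 : l₀) ⊗ₜ[l] f := hf.symm
  have hfq : f ∉ q := fun hfq => by
    apply hGx'
    apply hx'p.mem_of_pow_mem (p ^ n)
    rw [hGpow]
    have : f ∈ x'.comap (Algebra.TensorProduct.includeRight (R := l) (A := l₀) :
        F →ₐ[l] l₀ ⊗[l] F).toRingHom := by rw [hx']; exact hfq
    exact this
  have hsub : ↑(PrimeSpectrum.basicOpen ((1 : l₀) ⊗ₜ[l] f)) ⊆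
      Algebra.smoothLocus l₀ (l₀ ⊗[l] F) := by
    rw [← hGpow, PrimeSpectrum.basicOpen_pow _ _ (expChar_pow_pos l p n)]
    exact Algebra.basicOpen_subset_smoothLocus_iff_smooth.mpr hGsm
  have hsm1f : Algebra.Smooth l₀ (Localization.Away ((1 : l₀) ⊗ₜ[l] f)) :=
    Algebra.basicOpen_subset_smoothLocus_iff_smooth.mp hsub
  -- `l₀ ⊗ F_f ≅ (l₀ ⊗ F)_{1 ⊗ f}` is smooth over `l₀`; descend along the faithfully flat `l → l₀`
  let C := Localization.Away ((1 : l₀) ⊗ₜ[l] f)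
  have hmap : (Submonoid.powers f).map
      (Algebra.TensorProduct.includeRight (R := l) (A := l₀) : F →ₐ[l] l₀ ⊗[l] F) =
      Submonoid.powers ((1 : l₀) ⊗ₜ[l] f) := Submonoid.map_powers _ f
  haveI : IsLocalization ((Submonoid.powers f).map
      (Algebra.TensorProduct.includeRight (R := l) (A := l₀) : F →ₐ[l] l₀ ⊗[l] F)) C := by
    rw [hmap]; infer_instance
  let e : l₀ ⊗[l] Localization.Away f ≃ₐ[l₀] C :=
    IsLocalization.tensorProductEquivOfMapIncludeRight l l₀ (.powers f) (Localization.Away f) C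
  haveI : Algebra.Smooth l₀ C := hsm1f
  haveI : Algebra.Smooth l₀ (l₀ ⊗[l] Localization.Away f) := .of_equiv e.symm
  haveI : Algebra.Smooth l (Localization.Away f) :=
    Algebra.Smooth.of_smooth_tensorProduct_of_faithfullyFlat l₀
  -- hence `F` is `l`-smooth at `q`
  exact Algebra.basicOpen_subset_smoothLocus_iff_smooth.mpr ‹_›
    (show (⟨q, inferInstance⟩ : PrimeSpectrum F) ∈ (PrimeSpectrum.basicOpen f : Set _) from hfq)

end Descent

end Summit.ResolutionOfSingularities.ResolutionOfSingularities.Theorems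

end
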